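import Literature.AlgebraicGeometry.HodgeTheory.WeilLineDetOfLevelStructure
import Literature.AlgebraicGeometry.HodgeTheory.WeilLineSectionsOfUnimodularMonodromy
import HarnessLib

/-!
# Continuous Weil sections from an integral level-`n` structure on the monodromy

Family `hodge`, layer `Literature/AlgebraicGeometry/HodgeTheory`; the real-carrier packaging of
`WeilLineDetOfLevelStructure` (Deligne's `Γ = {g ∈ GL_{𝒪_E}(V(ℤ)) : g ψ = ψ, (g-1)V(ℤ) ⊂ nV(ℤ)}`,
`n ≥ 3`, acts with `det_E = 1`: [Deligne1982HodgeCycles], proof of Thm. 4.8;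
[vanGeemen1994HodgeAV, 5.9–5.11]) with `WeilLineSectionsOfUnimodularMonodromy`
(`exists_continuous_section_of_det_restrict_eq_one`: determinant-`1` monodromy on the eigenspaces
`V_±` of the global `√-p` makes every class of `Span(⌣ᵈ V₊) ⊔ Span(⌣ᵈ V₋)` extend to a continuous
section of `FiberClass π d`). For a family `π : 𝒳 ⟶ S` with an endomorphism `g` over `S` and a basis
`b` of `H¹(X_{s₁}(ℂ); ℂ)` in which `g_{s₁}^*` is an integer matrix `Jℤ`, `Jℤ² = -p`, and EVERY
monodromy at `s₁` is an integer matrix `≡ 1 (mod n)`, `n ≥ 3` (full level-`n` structure on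
`R¹ π_* ℤ`), the Weil plane is flat: `exists_continuous_section_of_integral_level`. This is the
continuous-section clause of the named facts `deligne1982_weilFamily_kAction` /
`deligne1982_weilFamily_globalAction` (`WeilFamilyKAction`, `WeilFamilyGlobalAction`) for a
constructor working with lattices and level structures. No definition, no named fact.

## References

* [Deligne1982HodgeCycles] P. Deligne (notes by J. S. Milne), Hodge cycles on abelian varieties,
  LNM 900 (1982), proof of Thm. 4.8, p. 50.
* [vanGeemen1994HodgeAV] B. van Geemen, LNM 1594 (1994), 5.8–5.11.
* [VoisinHodgeII2003] C. Voisin, Hodge Theory and Complex Algebraic Geometry II, CUP 2003, Lemma 4.17.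
-/

noncomputable section

namespace Literature.AlgebraicGeometry.HodgeTheory

open Module
/-! ### Real carriers: continuous Weil sections from an integral level structure on the monodromy -/

section Family

open CategoryTheory AlgebraicGeometry
open Literature.AlgebraicTopology.SingularHomology

variable {𝒳 S : Motives.SchemeOver ℂ} (π : 𝒳 ⟶ S)

/-- **Integral level-`n` monodromy makes the Weil plane flat.** Let `R¹ π_* ℂ` be a local system on
the path-connected, locally path-connected `S(ℂ)`, `g` an endomorphism of `𝒳` over `S` with fibre
maps `g_t`, and `b` a basis of `H¹(X_{s₁}(ℂ); ℂ)` (the integral lattice) in which `g_{s₁}^*` has an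
integer matrix `Jℤ` with `Jℤ² = -p` (`p ≥ 1`) and EVERY monodromy `γ_*` (`γ` a loop at `s₁`) has an
integer matrix congruent to `1` modulo some `n ≥ 3`. Then every class of the cohomological Weil plane
`Span(⌣ᵈ V₊) ⊔ Span(⌣ᵈ V₋)` (`V_± = V_{±μ}`, `μ² = -p`, with bases of `d` elements) extends to a
continuous section of `FiberClass π d` through it: the monodromy has determinant `1` on `V_±`
(`det_restrict_eigenspace_eq_one_of_level` — integrality of `γ_*` and `γ⁻¹_* = (γ⁻¹)_*`, commutation
with `g_{s₁}^*` by `transportFun_map_fiberHom`), so the tree's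
`exists_continuous_section_of_det_restrict_eq_one` applies. This is the flatness clause of Deligne's
Weil family over `Γ\X⁺`, `Γ` the level-`n` congruence group of `𝒪_E`-automorphisms of `V(ℤ)`,
`n ≥ 3` (LNM 900, proof of Thm. 4.8). [cite: Deligne1982HodgeCycles, proof of Thm. 4.8 (the group Γ, n ≥ 3) with Thm. 2.15] -/
theorem exists_continuous_section_of_integral_level
    (hU : IsCohomologicallyLocallyTrivialOn π (Set.univ : Set (Motives.ComplexPoints S)))
    [PathConnectedSpace (Motives.ComplexPoints S)]
    [LocallyPathConnectedSpace (Motives.ComplexPoints S)]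
    (g : 𝒳 ⟶ 𝒳) (hg : g ≫ π = π)
    (gf : ∀ t : Motives.ComplexPoints S, Motives.fiberOver π t ⟶ Motives.fiberOver π t)
    (hgf : ∀ t, gf t ≫ Motives.fiberι π t = Motives.fiberι π t ≫ g)
    (s₁ : Motives.ComplexPoints S) {ι : Type*} [Fintype ι] [DecidableEq ι]
    (b : Basis ι ℂ (complexBetti (Motives.fiberOver π s₁) 1))
    {p : ℕ} (hp : 0 < p) (Jℤ : Matrix ι ι ℤ)
    (hJ : LinearMap.toMatrix b b (complexBetti.map (gf s₁) 1).hom = Jℤ.map (Int.castRingHom ℂ))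
    (hJ2 : Jℤ * Jℤ = -((p : ℤ) • 1)) {n : ℕ} (hn : 3 ≤ n)
    (hlevel : ∀ γ : Path.Homotopic.Quotient
        (⟨s₁, Set.mem_univ s₁⟩ : (Set.univ : Set (Motives.ComplexPoints S))) ⟨s₁, Set.mem_univ s₁⟩,
      ∃ Dℤ : Matrix ι ι ℤ,
        LinearMap.toMatrix b b (transportLinear π 1 hU γ :) = (1 + (n : ℤ) • Dℤ).map (Int.castRingHom ℂ))
    (μ : ℂ) (hμ : μ ^ 2 = -(p : ℂ)) {d : ℕ}
    (bμ : Module.Basis (Fin d) ℂ (Module.End.eigenspace (complexBetti.map (gf s₁) 1).hom μ))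
    (bν : Module.Basis (Fin d) ℂ (Module.End.eigenspace (complexBetti.map (gf s₁) 1).hom (-μ)))
    {α : complexBetti (Motives.fiberOver π s₁) d}
    (hα : α ∈ Submodule.span ℂ
        {x | ∃ w : Fin d → complexBetti (Motives.fiberOver π s₁) 1,
          (∀ i, w i ∈ Module.End.eigenspace (complexBetti.map (gf s₁) 1).hom μ) ∧
          cupPowOne ℂ (Motives.ComplexPoints (Motives.fiberOver π s₁)) d w = x} ⊔
      Submodule.span ℂ
        {x | ∃ w : Fin d → complexBetti (Motives.fiberOver π s₁) 1,
          (∀ i, w i ∈ Module.End.eigenspace (complexBetti.map (gf s₁) 1).hom (-μ)) ∧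
          cupPowOne ℂ (Motives.ComplexPoints (Motives.fiberOver π s₁)) d w = x}) :
    ∃ σ : Motives.ComplexPoints S → FiberClass π d,
      Continuous σ ∧ (∀ s, (σ s).pt = s) ∧ σ s₁ = ⟨s₁, α⟩ := by
  classical
  haveI : FiniteDimensional ℂ (complexBetti (Motives.fiberOver π s₁) 1) := Module.Finite.of_basis b
  have hinj : Function.Injective fun A : Matrix ι ι ℤ ↦ A.map (Int.castRingHom ℂ) :=
    Matrix.map_injective (RingHom.injective_int (Int.castRingHom ℂ))
  have hmapmul : ∀ A B : Matrix ι ι ℤ,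
      (A * B).map (Int.castRingHom ℂ) = A.map (Int.castRingHom ℂ) * B.map (Int.castRingHom ℂ) :=
    fun A B ↦ Matrix.map_mul
  have hμ' : (-μ) ^ 2 = -(p : ℂ) := by rw [neg_sq, hμ]
  -- determinant `1` of every monodromy on the two eigenspaces
  have hdet1 : ∀ (γ : Path.Homotopic.Quotient
      (⟨s₁, Set.mem_univ s₁⟩ : (Set.univ : Set (Motives.ComplexPoints S))) ⟨s₁, Set.mem_univ s₁⟩)
      (ν : ℂ) (hν : ν ^ 2 = -(p : ℂ))
      (hE : ∀ v ∈ Module.End.eigenspace (complexBetti.map (gf s₁) 1).hom ν,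
        transportLinear π 1 hU γ v ∈ Module.End.eigenspace (complexBetti.map (gf s₁) 1).hom ν),
      LinearMap.det ((transportLinear π 1 hU γ :).restrict hE) = 1 := by
    intro γ ν hν hE
    obtain ⟨Dℤ, hD⟩ := hlevel γ
    obtain ⟨D'ℤ, hD'⟩ := hlevel γ.symm
    set Mℤ : Matrix ι ι ℤ := 1 + (n : ℤ) • Dℤ with hMℤ
    set M'ℤ : Matrix ι ι ℤ := 1 + (n : ℤ) • D'ℤ with hM'ℤ
    -- `γ_* (γ⁻¹)_* = id`
    have hcomp : (transportLinear π 1 hU γ :) * (transportLinear π 1 hU γ.symm :) = 1 := by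
      ext v
      change transportFun π 1 hU γ (transportFun π 1 hU γ.symm v) = v
      rw [← transportFun_trans, Path.Homotopic.Quotient.symm_trans, transportFun_refl]
    have hinv : Mℤ * M'ℤ = 1 := by
      apply hinj
      change (Mℤ * M'ℤ).map _ = (1 : Matrix ι ι ℤ).map _
      rw [hmapmul, ← hD, ← hD', ← LinearMap.toMatrix_mul, hcomp, LinearMap.toMatrix_one]
      ext i j
      simp only [Matrix.map_apply, Matrix.one_apply, eq_intCast, Int.cast_ite, Int.cast_one, Int.cast_zero]
    -- `γ_*` commutes with `g_{s₁}^*`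
    have hcommE : (transportLinear π 1 hU γ :) * (complexBetti.map (gf s₁) 1).hom =
        (complexBetti.map (gf s₁) 1).hom * (transportLinear π 1 hU γ :) := by
      ext v
      exact transportFun_map_fiberHom π 1 hU g hg gf hgf γ v
    have hcomm : Mℤ * Jℤ = Jℤ * Mℤ := by
      apply hinj
      change (Mℤ * Jℤ).map _ = (Jℤ * Mℤ).map _
      rw [hmapmul, hmapmul, ← hD, ← hJ, ← LinearMap.toMatrix_mul, ← LinearMap.toMatrix_mul, hcommE]
    exact det_restrict_eigenspace_eq_one_of_level b (complexBetti.map (gf s₁) 1).hom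
      (transportLinear π 1 hU γ :) Jℤ Mℤ M'ℤ Dℤ hJ hD hinv hp hJ2 hcomm hn rfl ν hν hE
  exact exists_continuous_section_of_det_restrict_eq_one π hU g hg gf hgf s₁ μ (-μ) bμ bν
    (fun γ ↦ ⟨hdet1 γ μ hμ _, hdet1 γ (-μ) hμ' _⟩) hα

end Family

end Literature.AlgebraicGeometry.HodgeTheory

end
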